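import Literature.Geometry.Lorentzian.ChartSecondFundamentalFormTranslation
import Literature.Geometry.Lorentzian.KerrData
import Literature.Geometry.Lorentzian.KerrSchildCoord
import HarnessLib

/-!
# `t*`-translation invariance of the data induced on hypersurfaces of the Kerr–Schild chart

The Kerr–Schild components `Kerr.bilin M a` do not depend on `t*` (`Kerr.bilin_add_smul_basisVector_zero`,
`KerrSchildCoord.lean`: `∂_{t*}` is a Killing field), the chart domain `Kerr.region a r₀` and the
time-orientation field `Kerr.timeVector M a` are invariant under `x ↦ x + t ∂_{t*}` as well. By the general
translation invariance of induced data on chart domains (`ChartSecondFundamentalFormTranslation.lean`), a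
parametrised hypersurface `f : U → Kerr.region a r₀` (`U ⊆ E'` a chart domain) and its `t*`-TRANSLATE
`f_t = f + t ∂_{t*}` have, with the same normal values, the same induced metric, the same causal/unit/future
character of the normal, and the same second fundamental form:

* `Kerr.timeVector_add_smul_basisVector_zero`, `Kerr.timeOrientation_vectorField_add_time` — invariance of
  the orientation field (the chart domain is invariant by `Kerr.add_smul_basisVector_zero_mem_region` of
  `KerrStationaryBlackHole.lean`);
* `Kerr.pullbackBilin_timeTranslate`, `Kerr.isSpacelikeImmersion_timeTranslate`,
  `Kerr.isFutureUnitNormal_timeTranslate`, `Kerr.secondFundamentalForm_timeTranslate`.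

Use: a datum which is, on some region, the data induced on the `t*`-translate of a model slice (a
Kerr–Schild leaf `{t* = c}`, the bent Boyer–Lindquist leaf `{t* = c + T(r)}`, a cylinder `{r = r₀}` entered at
`t* = τ₀`) is equally the data induced on the untranslated model slice — the freedom used to normalise the
phase `τ₀` of an exact Schwarzschild cylinder and to recognise a translated bent leaf as the Kerr shield of
the `FinalStateConjecture` routes. O'Neill 1983, Ch. 9, pp. 255–256 (flows of Killing fields are isometries)
with Ch. 3, Prop. 3.59 / Cor. 3.61 and Ch. 4, Lemma 4.4; Kerr–Schild 1965, §2.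

Everything is proved; no definitions, no named facts.

## References

* B. O'Neill, *Semi-Riemannian geometry with applications to relativity* (1983), Ch. 3, Prop. 3.59,
  Cor. 3.61; Ch. 4, Lemma 4.4; Ch. 9, pp. 255–256. [`ONeill1983`]
* R. P. Kerr, A. Schild, *A new class of vacuum solutions of the Einstein field equations* (1965), §2.
  [`KerrSchild1965`]
-/

noncomputable section

-- instance search through the nested operator type `E4 →L[ℝ] E4 →L[ℝ] ℝ` (as in the tree files)
set_option maxSynthPendingDepth 3

open Bundle Set Function TopologicalSpace Manifold
open scoped Manifold ContDiff Topology

namespace Literature.Geometry.Lorentzian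

namespace Kerr

/-! ### Invariance of the orientation field -/

/-- The time-orientation field `V = −g♯dt* = ∂₀ − 2H ℓ♯` is invariant under `t*`-translations.
[cite: KerrSchild1965, §2] -/
theorem timeVector_add_smul_basisVector_zero (M a : ℝ) (x : E4) (t : ℝ) :
    timeVector M a (x + t • E4.basisVector 0) = timeVector M a x := by
  simp only [timeVector, scalarH_add_smul_basisVector_zero, nullVector_add_smul_basisVector_zero]

/-- The components of the smooth Kerr metric are the Kerr–Schild form (the `hG` datum of the chart
calculus). [cite: KerrSchild1965, §2] -/
theorem smoothMetric_val_eq_bilin [Facts] (M a r₀ : ℝ) :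
    ∀ x : region a r₀, (smoothMetric M a r₀).val x = bilin M a (x : E4) := fun x ↦ smoothMetric_val M a r₀ x

/-- Stationarity of the components, in the form consumed by the chart calculus (the `hGw` datum).
[cite: KerrSchild1965, §2] -/
theorem bilin_add_time (M a t : ℝ) : ∀ x : E4, bilin M a (x + t • E4.basisVector 0) = bilin M a x :=
  fun x ↦ bilin_add_smul_basisVector_zero M a x t

/-- The orientation field of the smooth Kerr chart is invariant under `t*`-translations (the `hτ` datum).
[cite: KerrSchild1965, §2] -/
theorem timeOrientation_vectorField_add_time [Facts] (M a r₀ : ℝ) (hM : 0 ≤ M) (t : ℝ) :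
    ∀ x x' : region a r₀, (x' : E4) = x + t • E4.basisVector 0 →
      ((((timeOrientation M a r₀ hM).ofLE le_top : TimeOrientation (smoothMetric M a r₀))).vectorField x' : E4) =
        ((timeOrientation M a r₀ hM).ofLE le_top : TimeOrientation (smoothMetric M a r₀)).vectorField x := by
  intro x x' hx
  rw [TimeOrientation.vectorField_ofLE]
  change timeVector M a (x' : E4) = timeVector M a (x : E4)
  rw [hx, timeVector_add_smul_basisVector_zero]

/-! ### Translates of parametrised hypersurfaces -/

section Translate

variable [Facts] {E' : Type*} [NormedAddCommGroup E'] [NormedSpace ℝ E'] {U : Opens E'}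
  {M a r₀ t : ℝ} {f f' : U → region a r₀} (hf' : ∀ y, (f' y : E4) = f y + t • E4.basisVector 0)
include hf'

/-- **The induced metrics of a hypersurface and of its `t*`-translate agree** (pointwise, where `f` is
differentiable). [cite: ONeill1983, Ch. 3, Prop. 3.59] -/
theorem pullbackBilin_timeTranslate {y : U} (hfd : MDifferentiableAt 𝓘(ℝ, E') 𝓘(ℝ, E4) f y) :
    pullbackBilin (I := 𝓘(ℝ, E4)) (I' := 𝓘(ℝ, E')) f' (smoothMetric M a r₀).val y =
      pullbackBilin (I := 𝓘(ℝ, E4)) (I' := 𝓘(ℝ, E')) f (smoothMetric M a r₀).val y :=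
  OpensChart.pullbackBilin_translate (g := (smoothMetric M a r₀).toPseudoRiemannianMetric) hf'
    (smoothMetric_val_eq_bilin M a r₀) (bilin_add_time M a t) hfd

/-- **The `t*`-translate of a spacelike hypersurface is spacelike.** [cite: ONeill1983, Ch. 3, Prop. 3.59] -/
theorem isSpacelikeImmersion_timeTranslate (hsp : (smoothMetric M a r₀).IsSpacelikeImmersion 𝓘(ℝ, E') f) :
    (smoothMetric M a r₀).IsSpacelikeImmersion 𝓘(ℝ, E') f' :=
  OpensChart.isSpacelikeImmersion_translate (g := (smoothMetric M a r₀).toPseudoRiemannianMetric) hf'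
    (smoothMetric_val_eq_bilin M a r₀) (bilin_add_time M a t) hsp

/-- **The future unit normal keeps its values under `t*`-translation**: if `ν` is the future unit normal
of `f` (everywhere differentiable), the field with the same values is the future unit normal of the
translate `f'`. [cite: ONeill1983, Ch. 3, Prop. 3.59] -/
theorem isFutureUnitNormal_timeTranslate (hM : 0 ≤ M) {ν : NormalField 𝓘(ℝ, E4) f}
    {ν' : NormalField 𝓘(ℝ, E4) f'} (hν' : ∀ y, (ν' y : E4) = ν y)
    (hfd : ∀ y, MDifferentiableAt 𝓘(ℝ, E') 𝓘(ℝ, E4) f y)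
    (hfun : (smoothMetric M a r₀).IsFutureUnitNormal 𝓘(ℝ, E') ((timeOrientation M a r₀ hM).ofLE le_top) f ν) :
    (smoothMetric M a r₀).IsFutureUnitNormal 𝓘(ℝ, E') ((timeOrientation M a r₀ hM).ofLE le_top) f' ν' :=
  OpensChart.isFutureUnitNormal_translate (gL := smoothMetric M a r₀) hf' (smoothMetric_val_eq_bilin M a r₀)
    (bilin_add_time M a t) (timeOrientation_vectorField_add_time M a r₀ hM t) hν' hfd hfun

/-- **The second fundamental forms of a hypersurface and of its `t*`-translate agree**, for fields with a
common representative `N`, at every point where a representative `Φ` of `f` and `N` are differentiable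
(the Kerr–Schild components are differentiable on the chart domain). O'Neill 1983, Ch. 4, Lemma 4.4 with
Ch. 9, pp. 255–256. [cite: ONeill1983, Ch. 4, Lemma 4.4] -/
theorem secondFundamentalForm_timeTranslate [FiniteDimensional ℝ E'] [(smoothMetric M a r₀).HasLeviCivita]
    {Φ : E' → E4} (hf : ∀ y : U, (f y : E4) = Φ y) {ν : NormalField 𝓘(ℝ, E4) f}
    {ν' : NormalField 𝓘(ℝ, E4) f'} {N : E' → E4} (hν : ∀ y : U, ν y = N y) (hν' : ∀ y : U, ν' y = N y)
    {y : U} (hΦ : DifferentiableAt ℝ Φ y) (hN : DifferentiableAt ℝ N y) :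
    (smoothMetric M a r₀).secondFundamentalForm 𝓘(ℝ, E') f' ν' y =
      (smoothMetric M a r₀).secondFundamentalForm 𝓘(ℝ, E') f ν y :=
  OpensChart.secondFundamentalForm_translate (g := (smoothMetric M a r₀).toPseudoRiemannianMetric) hf'
    (smoothMetric_val_eq_bilin M a r₀) (bilin_add_time M a t) hf hν hν' hΦ hN
    (differentiableAt_bilin M a (f y))

end Translate

end Kerr

end Literature.Geometry.Lorentzian

end
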